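import Summits.Ventures.PercRepro.Night2ParallelGeneral
import Summits.Ventures.PercRepro.Night2LocalDQFour
import Summits.Ventures.PercRepro.Night2LocalFatOnly

/-!
# PercRepro — the `(6, 4)` shadow row reduces to two flat types of simple matroids (night-2, gen 11)

Putting the gen-11 pieces together: the parallel reduction (`shadowHall_diag_of_simple`, with the lower row
`shadowHall_five_three_phiK` on every matroid), gen 9's `shadowHall_of_local_fat` (a rank-`6` matroid satisfies
the `(6, 4)` shadow form once the local form holds at its rank-`5` flats `G` with `2 ≤ |E ∖ G| ≤ 4`) and the
regime `|E ∖ G| = 4` for simple matroids (`localShadowHall_dq_four_of_simple`):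

* `indep_singleton_of_simple_of_eRank`: a simple matroid of rank `≥ 2` is loopless;
* **`shadowHall_six_four_of_local_two_three`**: if the local form (LI_G) holds at every rank-`5` flat `G` with
  `|E ∖ G| ∈ {2, 3}` of every loopless simple matroid of rank `6`, then `ShadowHall M 6 4 (phiK 6 4)` holds for
  EVERY finite matroid — the exact open set of the `(6, 4)` row of `ShadowC025`, as a tree theorem;
* `shadowC025_of_simple_loopless`: `shadowC025_of_simple` with looplessness made explicit in the hypothesis.
-/

open scoped Matroid

namespace PercRepro.Shadow

open Finset PerFlat ThmH

variable {α : Type} [DecidableEq α]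

/-- A matroid of rank `≥ 2` in which any two distinct elements span rank `2` is loopless. -/
theorem indep_singleton_of_simple_of_eRank {M : Matroid α} [M.Finite]
    (hs : ∀ e ∈ gr M, ∀ f ∈ gr M, e ≠ f → rkN M {e, f} = 2) (hrk : ((2 : ℕ) : ℕ∞) ≤ M.eRank) :
    ∀ e ∈ gr M, M.Indep {e} := by
  intro e he
  have h2 : 2 ≤ rkN M (gr M) := by
    have : M.eRk ((gr M : Finset α) : Set α) = M.eRank := by rw [coe_gr]; exact Matroid.eRk_ground M
    have h := hrk
    rw [← this, eRk_eq_rkN] at h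
    exact_mod_cast h
  exact Matroid.indep_singleton.2 (isNonloop_of_simple hs h2 he)

/-- `Φ(6, 4) = 6/5 = (4 + 2)/(4 + 1)`. -/
theorem phiK_six_four_ratio : phiK 6 4 = (((4 : ℕ) : ℚ) + 2) / (((4 : ℕ) : ℚ) + 1) := by
  unfold phiK
  rw [show Finset.Ioo 4 6 = {5} by decide, Finset.sum_singleton,
    show Nat.choose (6 + 4) 5 = 252 by decide, show Nat.choose (6 + 4) 6 = 210 by decide]
  norm_num

/-- **The `(6, 4)` shadow row for every finite matroid, modulo the local form at the rank-`5` flats with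
`|E ∖ G| ∈ {2, 3}` of loopless simple rank-`6` matroids.**  Rank `< 6` has no bottom set, rank `≥ 6` truncates;
at rank `6` the parallel reduction leaves the simple matroids (lower row: `shadowHall_five_three_phiK`), where
`shadowHall_of_local_fat` needs the local form at `2 ≤ |E ∖ G| ≤ 4`: `|E ∖ G| = 4` is
`localShadowHall_dq_four_of_simple`, `|E ∖ G| ∈ {2, 3}` is the hypothesis. -/
theorem shadowHall_six_four_of_local_two_three
    (hloc : ∀ (N : Matroid α) [N.Finite], (∀ e ∈ gr N, ∀ f ∈ gr N, e ≠ f → rkN N {e, f} = 2) →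
      (∀ e ∈ gr N, N.Indep {e}) → N.eRank = ((6 : ℕ) : ℕ∞) →
      ∀ G ∈ flatsQ N (4 + 1), 2 ≤ (gr N \ G).card → (gr N \ G).card ≤ 3 → LocalShadowHall N 4 G)
    (M : Matroid α) [M.Finite] : ShadowHall M 6 4 (phiK 6 4) := by
  rw [phiK_six_four_ratio]
  -- the rank-6 case
  have hrank6 : ∀ (N : Matroid α) [N.Finite], N.eRank = ((4 + 2 : ℕ) : ℕ∞) →
      ShadowHall N (4 + 2) 4 ((((4 : ℕ) : ℚ) + 2) / (((4 : ℕ) : ℚ) + 1)) := by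
    intro N _ hN
    refine shadowHall_diag_of_simple (q := 4) (by norm_num) ?_ ?_ N hN
    · intro N' _
      have h := shadowHall_five_three_phiK N'
      have hc : phiK 5 3 = (((4 : ℕ) : ℚ) + 1) / ((4 : ℕ) : ℚ) := by
        rw [phiK_five_three_ratio]; norm_num
      rw [hc] at h
      exact h
    · intro N' _ hN' hs
      have hl : ∀ e ∈ gr N', N'.Indep {e} :=
        indep_singleton_of_simple_of_eRank hs (by rw [hN']; exact_mod_cast (by norm_num : 2 ≤ 4 + 2))
      have hrk : N'.eRk ((gr N' : Finset α) : Set α) = ((4 + 2 : ℕ) : ℕ∞) := by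
        rw [coe_gr, Matroid.eRk_ground]; exact hN'
      apply shadowHall_of_local_fat (q := 4) hrk
      intro G hG h2 h4
      rcases Nat.lt_or_ge (gr N' \ G).card 4 with hlt | hge
      · exact hloc N' hs hl hN' G hG h2 (by omega)
      · exact localShadowHall_dq_four_of_simple hs hl hG (by omega)
  by_cases hlt : M.eRank < ((6 : ℕ) : ℕ∞)
  · exact shadowHall_of_Uq_empty (Uq_eq_empty_of_eRank_lt hlt)
  · have hge : ((6 : ℕ) : ℕ∞) ≤ M.eRank := not_lt.1 hlt
    apply shadowHall_of_truncate M (by norm_num : (4 : ℕ) < 6)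
    apply hrank6
    rw [Matroid.eRank_def, PercRepro.Matroid.truncate_ground, PercRepro.Matroid.truncate_eRk_eq_of_ge]
    rw [Matroid.eRk_ground]
    exact hge

/-- **`ShadowC025` reduces to LOOPLESS simple matroids of rank `p`** (`shadowC025_of_simple` with the looplessness
that a simple matroid of rank `p ≥ 2` has, made explicit in the hypothesis). -/
theorem shadowC025_of_simple_loopless
    (hsimple : ∀ {β : Type} [DecidableEq β] (N : Matroid β) [N.Finite] (p q : ℕ), q + 2 ≤ p →
      N.eRank = (p : ℕ∞) → (∀ e ∈ gr N, ∀ f ∈ gr N, e ≠ f → rkN N {e, f} = 2) → (∀ e ∈ gr N, N.Indep {e}) →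
      ShadowHall N p q (phiK p q)) : ShadowC025 := by
  apply shadowC025_of_simple
  intro β _ N _ p q hpq hN hs
  apply hsimple N p q hpq hN hs
  apply indep_singleton_of_simple_of_eRank hs
  rw [hN]
  exact_mod_cast (by omega : 2 ≤ p)

end PercRepro.Shadow
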